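import Mathlib
import Summits.Ventures.PercRepro2.TypedTwoEdgesAtOClasses
import Summits.Ventures.PercRepro2.TypedBasesStarRefutation

/-!
# NEG-191 as a superadditivity defect, in the kernel (blind cell PercRepro2, night-3 g16, 2026-08-27)

On night-3 g15's witness of NEG-191 (typer-1 g45's `TriOWitness`: seven vertices, nine edges, the
`o`-star `{l–o, o–u₂}` = edges `0` and `5`, type vector `138`), the deletion–contraction identity
`typedCount_two_edges_at_o` and the three raw class sums `18 / 0 / −20` of the refutation give,
without any further enumeration,

  `N_τ = 2 · N_τ(F ∖ {l–o}) + 2 · N_τ(F ∖ {o–u₂}) − 2`   (`witness_superadditivity_defect`):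

the typed count of the witness falls short of twice the two single attachments of `o` by exactly
`2` (the «−4 per class in 6·K^sym units» of NIGHT3-CERT.md §24.9 = `D₂ = −2` in typed-count
units).  Own work; standard axioms.
-/

namespace Summit.Ventures.PercRepro2

namespace CovForm

namespace TriOWitness

open TypedRed

/-- The `o`-star of the witness is the pair `{0, 5}`. -/
lemma wS_eq : wS = ({0, 5} : Finset (Fin 9)) := by decide

/-- The colouring `wOpen` opens exactly the edges `0` and `5`. -/
lemma wOpen_eq : wOpen = pairCol (0 : Fin 9) 5 := by
  funext e
  fin_cases e <;> rfl

/-- The closed colouring is `zeroCol`. -/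
lemma wZ_eq : wZ = zeroCol := rfl

/-- **The double-attachment class of the witness is `−2`** (`18 + 0 − 20`). -/
lemma doubleClass_witness :
    doubleClass Finset.univ wZ wτ (0 : Fin 9) 5 (K3 (R := ℚ) wEnds 2 0 1 4 3) = -2 := by
  rw [doubleClass_eq_sum_classes Finset.univ 0 5 (Finset.mem_univ _) (Finset.mem_univ _)
    (by decide) wZ wτ (by decide) (by decide), ← wS_eq, ← wOpen_eq, ← wZ_eq, classSum_x,
    classSum_y, classSum_w]
  norm_num

/-- **NEG-191 in deletion form**: on the witness,
`N_τ = 2 · N_τ(F ∖ {l–o}) + 2 · N_τ(F ∖ {o–u₂}) − 2`. -/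
theorem witness_superadditivity_defect :
    typedCount Finset.univ wZ wτ (K3 (R := ℚ) wEnds 2 0 1 4 3) =
      2 * typedCount (Finset.univ.erase 0) (Function.update wZ 0 false) wτ
          (K3 (R := ℚ) wEnds 2 0 1 4 3) +
        2 * typedCount (Finset.univ.erase 5) (Function.update wZ 5 false) wτ
          (K3 (R := ℚ) wEnds 2 0 1 4 3) - 2 := by
  have h := typedCount_two_edges_at_o (R := ℚ) wEnds 2 0 1 4 3 (e := 0) (f := 5) (u := 0) (v := 6)
    (by decide) (by decide) (by decide) (by decide) (by decide) (by decide) (by decide) (by decide)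
    (by decide) Finset.univ (Finset.mem_univ _) (Finset.mem_univ _) wZ wτ (by decide) (by decide)
    (fun e' he he' ho => absurd ho (by revert e' he he'; decide))
  rw [doubleClass_witness] at h
  linarith

end TriOWitness

end CovForm

end Summit.Ventures.PercRepro2
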